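import Summits.CriticalPhenomena.PercolationContinuityZ3.Theorems.Transplant.FKConnectivityAllQPat3MinorFunctionals
import Summits.CriticalPhenomena.PercolationContinuityZ3.Theorems.Transplant.FKConnectivityAllQPat3TwoLevelInduction
import HarnessLib

/-!
# Connectivity correlation inequalities for `φ_{w,q}`, every `q > 0` — THEOREMS 𝒯₁/𝒯₂ ON EVERY MINOR OF A TWO-TERMINAL SERIES–PARALLEL PIECE

Proof file (`--supports stmt-CriticalPhenomena-4575`), census lineage (gen 37) of LANE 2's FK sub-programme; builds on p205010
(kernel theorem, internal audit signed; external expert review pending).  No definitions, no named facts, no sorries.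

**`FK.famT12C_nonneg`**: for a two-terminal series–parallel network `N` between `x, y`, an inner vertex `s` of `N`, and ANY free set
`E ⊆ N` and contracted set `C ⊆ N` (the other edges deleted), every member of census g34's family
`famT12 = [T_sym, STAR_x, STAR_y, STAR_s, C1, C1~, C2, C2~, C3, C3~, S¹C1, S¹C1~, S¹C3, S¹C3~]` is nonnegative on the MINOR
`(E, C)` read on `(x, y, s)` for every nonnegative level weight (`FK.mval2C`), hence levelwise (`FK.lev2C`).  This is census g37's
question Q-minor (memo FROM-census-g37-THEOREM-SP-TTSP §4; census: 5.9·10⁶ + exhaustive small minors, 0 negatives) answered in the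
kernel, and the generator-validity input for lifting THEOREM SP from networks to their minors (⇒ `δ_w ≥ 0` for arbitrary weights,
via `FK.two_mul_deltaMass_eq_sum_antipodal`).  PROOF: census g36's closed-family induction `FK.fam_nonneg_of_isTTSP` verbatim with
the contracted set riding along — the SAME `decide`d certificates (`famT12_cert_par/serL/serR/serS`): the two-mark side of a gluing
enters only through nonnegative class/level counts (of its minor), the three-mark side through the induction hypothesis on ITS
minor; C-steps `FK.mval2C_par/serL/serR/serS_nonneg`.
[cite: AyyerLinussonRavichandran2025, §7 (p. 22)] [cite: Grimmett2006, §3.8 (pp. 61–62)]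
-/

namespace Summit.CriticalPhenomena.PercolationContinuityZ3.Theorems

namespace FK

open SimpleGraph Literature.Probability.LatticeModels Literature.Probability.Percolation
open scoped Classical

variable {V : Type*} [Fintype V]

/-! ### The four gluing steps on minors -/

section MinorSteps

omit [Fintype V] in
/-- Vertex-set bookkeeping: a sub-configuration of `N` (free part inside `E ⊆ N`, contracted part `C ⊆ N`) spans inside the span
of `N`. [folklore] -/
theorem span_sub_of_subset {N E C : Finset (Sym2 V)} {W : Set V} (hN : ∀ e ∈ (↑N : Set (Sym2 V)), ∀ z ∈ e, z ∈ W)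
    (hE : E ⊆ N) (hC : C ⊆ N) : ∀ e ∈ (↑(E ∪ C) : Set (Sym2 V)), ∀ z ∈ e, z ∈ W := fun e he z hz =>
  hN e (Finset.mem_coe.2 (Finset.union_subset hE hC (Finset.mem_coe.1 he))) z hz

/-- **PARALLEL step on minors**: two-mark side `(EA, CA) ⊆ NA`, three-mark side `(EB, CB) ⊆ NB` carrying the inner mark `s`.
[folklore] -/
theorem mval2C_par_nonneg {NA NB EA EB CA CB : Finset (Sym2 V)} {VA VB : Set V} (hdN : Disjoint NA NB)
    (hA : ∀ e ∈ (↑NA : Set (Sym2 V)), ∀ z ∈ e, z ∈ VA) (hB : ∀ e ∈ (↑NB : Set (Sym2 V)), ∀ z ∈ e, z ∈ VB)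
    (hEA : EA ⊆ NA) (hCA : CA ⊆ NA) (hEB : EB ⊆ NB) (hCB : CB ⊆ NB)
    {x y s : V} (hS : VA ∩ VB ⊆ {x, y}) (hxy : x ≠ y) (hsV : s ∉ VA) (hsx : s ≠ x) (hsy : s ≠ y)
    {F : ℕ → Pat3 → Pat3 → ℤ} {G : Bool → Bool → ℕ → Pat3 → Pat3 → ℤ} {m k : Bool → Bool → ℕ} (hk : ∀ a a', k a a' + 1 < 4)
    (hdom : ∀ a a', ∀ c < 4, ∀ P Q,
      (m a a' : ℤ) * (shift2 (G a a') (k a a') c P Q + shift2 (G a a') (k a a') c Q P) ≤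
        2 * ((fib2 F joinPar corrPar a a' c P Q + fib2 F joinPar corrPar a' a c P Q) +
          (fib2 F joinPar corrPar a a' c Q P + fib2 F joinPar corrPar a' a c Q P)))
    (ihG : ∀ a a', ∀ w' : ℕ → ℝ, (∀ n, 0 ≤ w' n) → 0 ≤ mval2C w' EB CB x y s (G a a'))
    (w : ℕ → ℝ) (hw : ∀ n, 0 ≤ w n) : 0 ≤ mval2C w (EA ∪ EB) (CA ∪ CB) x y s F := by
  have hA' := span_sub_of_subset hA hEA hCA
  have hB' := span_sub_of_subset hB hEB hCB
  have hd : Disjoint EA EB := Finset.disjoint_of_subset_left hEA (Finset.disjoint_of_subset_right hEB hdN)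
  refine mval2C_union_nonneg hd (fun γ => conn (γ ∪ CA) x y) joinPar corrPar
    (fun γA hγA γB hγB => pat3_union_par hA' hB' hS hsV hsx hsy (Finset.union_subset_union hγA le_rfl)
      (Finset.union_subset_union hγB le_rfl))
    (fun γA hγA γB hγB => ?_) (by decide) F G m k hk hdom ihG w hw
  rw [apExpC_parallel_glued hd hA' hB' hS hxy hγA hγB, ite_and_eq_corrPar (γA ∪ CA) (γB ∪ CB) x y s,
    ite_and_eq_corrPar (EA \ γA ∪ CA) (EB \ γB ∪ CB) x y s]

/-- **SERIES step on minors, mark in the second part.** [folklore] -/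
theorem mval2C_serL_nonneg {N₁ N₂ E₁ E₂ C₁ C₂ : Finset (Sym2 V)} {V₁ V₂ : Set V} (hdN : Disjoint N₁ N₂)
    (h₁ : ∀ e ∈ (↑N₁ : Set (Sym2 V)), ∀ z ∈ e, z ∈ V₁) (h₂ : ∀ e ∈ (↑N₂ : Set (Sym2 V)), ∀ z ∈ e, z ∈ V₂)
    (hE₁ : E₁ ⊆ N₁) (hC₁ : C₁ ⊆ N₁) (hE₂ : E₂ ⊆ N₂) (hC₂ : C₂ ⊆ N₂)
    {x m₀ y s : V} (hS : V₁ ∩ V₂ ⊆ {m₀}) (hxV : x ∉ V₂) (hyV : y ∉ V₁) (hsV : s ∉ V₁) (hxm : x ≠ m₀) (hym : y ≠ m₀)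
    (hxy : x ≠ y) (hsm : s ≠ m₀) (hxs : x ≠ s)
    {F : ℕ → Pat3 → Pat3 → ℤ} {G : Bool → Bool → ℕ → Pat3 → Pat3 → ℤ} {m k : Bool → Bool → ℕ} (hk : ∀ a a', k a a' + 1 < 4)
    (hdom : ∀ a a', ∀ c < 4, ∀ P Q,
      (m a a' : ℤ) * (shift2 (G a a') (k a a') c P Q + shift2 (G a a') (k a a') c Q P) ≤
        2 * ((fib2 F joinSerL corrZero a a' c P Q + fib2 F joinSerL corrZero a' a c P Q) +
          (fib2 F joinSerL corrZero a a' c Q P + fib2 F joinSerL corrZero a' a c Q P)))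
    (ihG : ∀ a a', ∀ w' : ℕ → ℝ, (∀ n, 0 ≤ w' n) → 0 ≤ mval2C w' E₂ C₂ m₀ y s (G a a'))
    (w : ℕ → ℝ) (hw : ∀ n, 0 ≤ w n) : 0 ≤ mval2C w (E₁ ∪ E₂) (C₁ ∪ C₂) x y s F := by
  have h₁' := span_sub_of_subset h₁ hE₁ hC₁
  have h₂' := span_sub_of_subset h₂ hE₂ hC₂
  have hd : Disjoint E₁ E₂ := Finset.disjoint_of_subset_left hE₁ (Finset.disjoint_of_subset_right hE₂ hdN)
  refine mval2C_union_nonneg hd (fun γ => conn (γ ∪ C₁) x m₀) joinSerL corrZero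
    (fun γA hγA γB hγB => pat3_union_serL h₁' h₂' hS hxV hyV hsV hxm hym hxy hsm hxs (Finset.union_subset_union hγA le_rfl)
      (Finset.union_subset_union hγB le_rfl))
    (fun γA hγA γB hγB => ?_) (by decide) F G m k hk hdom ihG w hw
  simp only [corrZero, add_zero]
  exact apExpC_series_glued hd h₁' h₂' hS hγA hγB

/-- **SERIES step on minors, mark in the first part.** [folklore] -/
theorem mval2C_serR_nonneg {N₁ N₂ E₁ E₂ C₁ C₂ : Finset (Sym2 V)} {V₁ V₂ : Set V} (hdN : Disjoint N₁ N₂)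
    (h₁ : ∀ e ∈ (↑N₁ : Set (Sym2 V)), ∀ z ∈ e, z ∈ V₁) (h₂ : ∀ e ∈ (↑N₂ : Set (Sym2 V)), ∀ z ∈ e, z ∈ V₂)
    (hE₁ : E₁ ⊆ N₁) (hC₁ : C₁ ⊆ N₁) (hE₂ : E₂ ⊆ N₂) (hC₂ : C₂ ⊆ N₂)
    {x m₀ y s : V} (hS : V₁ ∩ V₂ ⊆ {m₀}) (hxV : x ∉ V₂) (hsV : s ∉ V₂) (hyV : y ∉ V₁) (hxm : x ≠ m₀) (hym : y ≠ m₀)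
    (hxy : x ≠ y) (hsm : s ≠ m₀) (hsy : s ≠ y)
    {F : ℕ → Pat3 → Pat3 → ℤ} {G : Bool → Bool → ℕ → Pat3 → Pat3 → ℤ} {m k : Bool → Bool → ℕ} (hk : ∀ a a', k a a' + 1 < 4)
    (hdom : ∀ a a', ∀ c < 4, ∀ P Q,
      (m a a' : ℤ) * (shift2 (G a a') (k a a') c P Q + shift2 (G a a') (k a a') c Q P) ≤
        2 * ((fib2 F joinSerR corrZero a a' c P Q + fib2 F joinSerR corrZero a' a c P Q) +
          (fib2 F joinSerR corrZero a a' c Q P + fib2 F joinSerR corrZero a' a c Q P)))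
    (ihG : ∀ a a', ∀ w' : ℕ → ℝ, (∀ n, 0 ≤ w' n) → 0 ≤ mval2C w' E₁ C₁ x m₀ s (G a a'))
    (w : ℕ → ℝ) (hw : ∀ n, 0 ≤ w n) : 0 ≤ mval2C w (E₁ ∪ E₂) (C₁ ∪ C₂) x y s F := by
  have h₁' := span_sub_of_subset h₁ hE₁ hC₁
  have h₂' := span_sub_of_subset h₂ hE₂ hC₂
  have hd : Disjoint E₁ E₂ := Finset.disjoint_of_subset_left hE₁ (Finset.disjoint_of_subset_right hE₂ hdN)
  rw [Finset.union_comm E₁, Finset.union_comm C₁]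
  refine mval2C_union_nonneg hd.symm (fun γ => conn (γ ∪ C₂) m₀ y) joinSerR corrZero
    (fun γA hγA γB hγB => ?_) (fun γA hγA γB hγB => ?_) (by decide) F G m k hk hdom ihG w hw
  · rw [Finset.union_comm]
    exact pat3_union_serR h₁' h₂' hS hxV hsV hyV hxm hym hxy hsm hsy (Finset.union_subset_union hγB le_rfl)
      (Finset.union_subset_union hγA le_rfl)
  · simp only [corrZero, add_zero]
    rw [Finset.union_comm E₂, Finset.union_comm C₂, Finset.union_comm γA, add_comm (apExpC E₂ C₂ γA)]
    exact apExpC_series_glued hd h₁' h₂' hS hγB hγA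

/-- **SERIES step on minors, at the mark.** [folklore] -/
theorem mval2C_serS_nonneg {N₁ N₂ E₁ E₂ C₁ C₂ : Finset (Sym2 V)} {V₁ V₂ : Set V} (hdN : Disjoint N₁ N₂)
    (h₁ : ∀ e ∈ (↑N₁ : Set (Sym2 V)), ∀ z ∈ e, z ∈ V₁) (h₂ : ∀ e ∈ (↑N₂ : Set (Sym2 V)), ∀ z ∈ e, z ∈ V₂)
    (hE₁ : E₁ ⊆ N₁) (hC₁ : C₁ ⊆ N₁) (hE₂ : E₂ ⊆ N₂) (hC₂ : C₂ ⊆ N₂)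
    {x s y : V} (hS : V₁ ∩ V₂ ⊆ {s}) (hxV : x ∉ V₂) (hyV : y ∉ V₁) (hxs : x ≠ s) (hys : y ≠ s) (hxy : x ≠ y)
    {F : ℕ → Pat3 → Pat3 → ℤ}
    (hcert : ∀ a a' b b' : Bool, ∀ c < 2, 0 ≤ F c (joinSerS a b) (joinSerS a' b') + F c (joinSerS a b') (joinSerS a' b))
    (w : ℕ → ℝ) (hw : ∀ n, 0 ≤ w n) : 0 ≤ mval2C w (E₁ ∪ E₂) (C₁ ∪ C₂) x y s F := by
  have h₁' := span_sub_of_subset h₁ hE₁ hC₁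
  have h₂' := span_sub_of_subset h₂ hE₂ hC₂
  have hd : Disjoint E₁ E₂ := Finset.disjoint_of_subset_left hE₁ (Finset.disjoint_of_subset_right hE₂ hdN)
  exact mval2C_union_nonneg₂ hd (fun γ => conn (γ ∪ C₁) x s) (fun γ => conn (γ ∪ C₂) s y)
    (fun _ hγ₁ _ hγ₂ => pat3_union_serS h₁' h₂' hS hxV hyV hxs hys hxy (Finset.union_subset_union hγ₁ le_rfl)
      (Finset.union_subset_union hγ₂ le_rfl))
    (fun _ hγ₁ _ hγ₂ => apExpC_series_glued hd h₁' h₂' hS hγ₁ hγ₂) F hcert w hw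

end MinorSteps

/-! ### The closed-family induction on minors -/

section MinorInduction

omit [Fintype V] in
/-- Restricting a subset of a disjoint union to the two parts. [folklore] -/
theorem subset_union_split {E N₁ N₂ : Finset (Sym2 V)} (hE : E ⊆ N₁ ∪ N₂) : E = E ∩ N₁ ∪ E ∩ N₂ := by
  rw [← Finset.inter_union_distrib_left, Finset.inter_eq_left.2 hE]

/-- **CLOSED FAMILIES ARE VALID ON EVERY MINOR OF A TWO-TERMINAL SERIES–PARALLEL 3-MARK PIECE** (census g37): the hypotheses of
census g36's `FK.fam_nonneg_of_isTTSP` (the four `decide`d closure checks) give nonnegativity of every member on every minor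
`(E, C)`, `E, C ⊆ N`, of the network `N` read on `(x, y, s)` with `s` an inner vertex of `N`, for every nonnegative weight.
[cite: AyyerLinussonRavichandran2025, §7 (p. 22)] -/
theorem famC_nonneg_of_isTTSP {Fam : List (ℕ → Pat3 → Pat3 → ℤ)} {selP selL selR : ℕ → Bool → Bool → ℕ × ℕ × ℕ}
    (hP : certGlueFam Fam joinPar corrPar selP = true) (hL : certGlueFam Fam joinSerL corrZero selL = true)
    (hR : certGlueFam Fam joinSerR corrZero selR = true) (hS : certSerSFam Fam = true)
    {N : Finset (Sym2 V)} {x y : V} (hN : IsTTSP N x y) :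
    ∀ E C : Finset (Sym2 V), E ⊆ N → C ⊆ N → ∀ s : V, (∃ e ∈ N, s ∈ e) → s ≠ x → s ≠ y →
      ∀ w : ℕ → ℝ, (∀ n, 0 ≤ w n) → ∀ i : ℕ, 0 ≤ mval2C w E C x y s (famGet Fam i) := by
  induction hN with
  | @edge a b hab =>
    intro E C _ _ s hs hsa hsb w hw i
    obtain ⟨e, he, hse⟩ := hs
    rw [Finset.mem_singleton] at he
    subst he
    rcases Sym2.mem_iff.1 hse with h | h
    · exact absurd h hsa
    · exact absurd h hsb
  | @series N₁ N₂ a m₀ b h₁ h₂ hd hV ha hb ih₁ ih₂ =>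
    intro E C hE hC s hs hsa hsb w hw i
    by_cases hi : Fam.length ≤ i
    · rw [famGet_of_le hi, mval2C_zero]
    have hi' : i < Fam.length := lt_of_not_ge hi
    have g₁ : ∀ e ∈ (↑N₁ : Set (Sym2 V)), ∀ z ∈ e, z ∈ {z : V | ∃ e ∈ N₁, z ∈ e} := fun e he z hz => ⟨e, he, hz⟩
    have g₂ : ∀ e ∈ (↑N₂ : Set (Sym2 V)), ∀ z ∈ e, z ∈ {z : V | ∃ e ∈ N₂, z ∈ e} := fun e he z hz => ⟨e, he, hz⟩
    have gS : {z : V | ∃ e ∈ N₁, z ∈ e} ∩ {z : V | ∃ e ∈ N₂, z ∈ e} ⊆ ({m₀} : Set V) :=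
      fun z hz => hV z hz.1 hz.2
    have gaV₂ : a ∉ {z : V | ∃ e ∈ N₂, z ∈ e} := fun ⟨e, he, hae⟩ => ha e he hae
    have gbV₁ : b ∉ {z : V | ∃ e ∈ N₁, z ∈ e} := fun ⟨e, he, hbe⟩ => hb e he hbe
    have gam : a ≠ m₀ := by
      obtain ⟨e, he, hme⟩ := h₂.left_mem
      intro ham; exact ha e he (ham ▸ hme)
    have gbm : b ≠ m₀ := by
      obtain ⟨e, he, hme⟩ := h₁.right_mem
      intro hbm; exact hb e he (hbm ▸ hme)
    have gab : a ≠ b := by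
      obtain ⟨e, he, hae⟩ := h₁.left_mem
      intro hab; exact hb e he (hab ▸ hae)
    rw [subset_union_split hE, subset_union_split hC]
    have sE₁ : E ∩ N₁ ⊆ N₁ := Finset.inter_subset_right
    have sE₂ : E ∩ N₂ ⊆ N₂ := Finset.inter_subset_right
    have sC₁ : C ∩ N₁ ⊆ N₁ := Finset.inter_subset_right
    have sC₂ : C ∩ N₂ ⊆ N₂ := Finset.inter_subset_right
    by_cases hsm : s = m₀
    · subst hsm
      exact mval2C_serS_nonneg hd g₁ g₂ sE₁ sC₁ sE₂ sC₂ gS gaV₂ gbV₁ gam gbm gab (certSerSFam_spec hS hi') w hw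
    · obtain ⟨e, he, hse⟩ := hs
      rcases Finset.mem_union.1 he with he₁ | he₂
      · have hsV₂ : s ∉ {z : V | ∃ e ∈ N₂, z ∈ e} := fun hs₂ => hsm (hV s ⟨e, he₁, hse⟩ hs₂)
        exact mval2C_serR_nonneg hd g₁ g₂ sE₁ sC₁ sE₂ sC₂ gS gaV₂ hsV₂ gbV₁ gam gbm gab hsm hsb
          (G := fun a' a'' => famGet Fam (selR i a' a'').1) (m := fun a' a'' => (selR i a' a'').2.1)
          (k := fun a' a'' => (selR i a' a'').2.2) (fun a' a'' => (certGlueFam_spec hR hi' a' a'').1)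
          (fun a' a'' => (certGlueFam_spec hR hi' a' a'').2)
          (fun a' a'' w' hw' => ih₁ _ _ sE₁ sC₁ s ⟨e, he₁, hse⟩ hsa hsm w' hw' _) w hw
      · have hsV₁ : s ∉ {z : V | ∃ e ∈ N₁, z ∈ e} := fun hs₁ => hsm (hV s hs₁ ⟨e, he₂, hse⟩)
        have has : a ≠ s := fun h => gaV₂ (h ▸ ⟨e, he₂, hse⟩)
        exact mval2C_serL_nonneg hd g₁ g₂ sE₁ sC₁ sE₂ sC₂ gS gaV₂ gbV₁ hsV₁ gam gbm gab hsm has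
          (G := fun a' a'' => famGet Fam (selL i a' a'').1) (m := fun a' a'' => (selL i a' a'').2.1)
          (k := fun a' a'' => (selL i a' a'').2.2) (fun a' a'' => (certGlueFam_spec hL hi' a' a'').1)
          (fun a' a'' => (certGlueFam_spec hL hi' a' a'').2)
          (fun a' a'' w' hw' => ih₂ _ _ sE₂ sC₂ s ⟨e, he₂, hse⟩ hsm hsb w' hw' _) w hw
  | @parallel N₁ N₂ a b h₁ h₂ hd hV ih₁ ih₂ =>
    intro E C hE hC s hs hsa hsb w hw i
    by_cases hi : Fam.length ≤ i
    · rw [famGet_of_le hi, mval2C_zero]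
    have hi' : i < Fam.length := lt_of_not_ge hi
    have g₁ : ∀ e ∈ (↑N₁ : Set (Sym2 V)), ∀ z ∈ e, z ∈ {z : V | ∃ e ∈ N₁, z ∈ e} := fun e he z hz => ⟨e, he, hz⟩
    have g₂ : ∀ e ∈ (↑N₂ : Set (Sym2 V)), ∀ z ∈ e, z ∈ {z : V | ∃ e ∈ N₂, z ∈ e} := fun e he z hz => ⟨e, he, hz⟩
    have gS : {z : V | ∃ e ∈ N₁, z ∈ e} ∩ {z : V | ∃ e ∈ N₂, z ∈ e} ⊆ ({a, b} : Set V) := by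
      intro z hz
      rcases hV z hz.1 hz.2 with h | h
      · exact Or.inl h
      · exact Or.inr h
    have gS' : {z : V | ∃ e ∈ N₂, z ∈ e} ∩ {z : V | ∃ e ∈ N₁, z ∈ e} ⊆ ({a, b} : Set V) :=
      fun z hz => gS ⟨hz.2, hz.1⟩
    have gab : a ≠ b := h₁.ne
    rw [subset_union_split hE, subset_union_split hC]
    have sE₁ : E ∩ N₁ ⊆ N₁ := Finset.inter_subset_right
    have sE₂ : E ∩ N₂ ⊆ N₂ := Finset.inter_subset_right
    have sC₁ : C ∩ N₁ ⊆ N₁ := Finset.inter_subset_right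
    have sC₂ : C ∩ N₂ ⊆ N₂ := Finset.inter_subset_right
    obtain ⟨e, he, hse⟩ := hs
    rcases Finset.mem_union.1 he with he₁ | he₂
    · have hsV₂ : s ∉ {z : V | ∃ e ∈ N₂, z ∈ e} := by
        intro hs₂
        rcases hV s ⟨e, he₁, hse⟩ hs₂ with h | h
        · exact hsa h
        · exact hsb h
      rw [Finset.union_comm (E ∩ N₁), Finset.union_comm (C ∩ N₁)]
      exact mval2C_par_nonneg hd.symm g₂ g₁ sE₂ sC₂ sE₁ sC₁ gS' gab hsV₂ hsa hsb
        (G := fun a' a'' => famGet Fam (selP i a' a'').1) (m := fun a' a'' => (selP i a' a'').2.1)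
        (k := fun a' a'' => (selP i a' a'').2.2) (fun a' a'' => (certGlueFam_spec hP hi' a' a'').1)
        (fun a' a'' => (certGlueFam_spec hP hi' a' a'').2)
        (fun a' a'' w' hw' => ih₁ _ _ sE₁ sC₁ s ⟨e, he₁, hse⟩ hsa hsb w' hw' _) w hw
    · have hsV₁ : s ∉ {z : V | ∃ e ∈ N₁, z ∈ e} := by
        intro hs₁
        rcases hV s hs₁ ⟨e, he₂, hse⟩ with h | h
        · exact hsa h
        · exact hsb h
      exact mval2C_par_nonneg hd g₁ g₂ sE₁ sC₁ sE₂ sC₂ gS gab hsV₁ hsa hsb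
        (G := fun a' a'' => famGet Fam (selP i a' a'').1) (m := fun a' a'' => (selP i a' a'').2.1)
        (k := fun a' a'' => (selP i a' a'').2.2) (fun a' a'' => (certGlueFam_spec hP hi' a' a'').1)
        (fun a' a'' => (certGlueFam_spec hP hi' a' a'').2)
        (fun a' a'' w' hw' => ih₂ _ _ sE₂ sC₂ s ⟨e, he₂, hse⟩ hsa hsb w' hw' _) w hw

/-- **THEOREMS 𝒯₁/𝒯₂ ON MINORS (census g37's Q-minor, kernel form):** every member of `famT12` is nonnegative, for every
nonnegative weight, on every minor `(E, C)` (`E, C ⊆ N`) of a two-terminal series–parallel network `N` between `x` and `y` read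
on `(x, y, s)` with `s` an inner vertex of `N`. [cite: AyyerLinussonRavichandran2025, §7 (p. 22)] -/
theorem famT12C_nonneg {N E C : Finset (Sym2 V)} {x y s : V} (hN : IsTTSP N x y) (hE : E ⊆ N) (hC : C ⊆ N)
    (hs : ∃ e ∈ N, s ∈ e) (hsx : s ≠ x) (hsy : s ≠ y) {w : ℕ → ℝ} (hw : ∀ n, 0 ≤ w n) (i : ℕ) :
    0 ≤ mval2C w E C x y s (famGet famT12 i) :=
  famC_nonneg_of_isTTSP famT12_cert_par famT12_cert_serL famT12_cert_serR famT12_cert_serS hN E C hE hC s hs hsx hsy w hw i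

/-- **`T_sym ≥ 0` levelwise on every minor of a two-terminal series–parallel 3-mark piece.** [cite: AyyerLinussonRavichandran2025, §7 (p. 22)] -/
theorem tsymC_level_nonneg {N E C : Finset (Sym2 V)} {x y s : V} (hN : IsTTSP N x y) (hE : E ⊆ N) (hC : C ⊆ N)
    (hs : ∃ e ∈ N, s ∈ e) (hsx : s ≠ x) (hsy : s ≠ y) (μ : ℕ) : 0 ≤ lev2C E C x y s tsym2Tab μ :=
  lev2C_nonneg_of_mval2C (fun _ hw => famT12C_nonneg hN hE hC hs hsx hsy hw 0) μ

/-- **`STAR(x; y, s) ≥ 0` levelwise on every minor of a two-terminal series–parallel 3-mark piece.** [cite: AyyerLinussonRavichandran2025, §7 (p. 22)] -/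
theorem starXC_level_nonneg {N E C : Finset (Sym2 V)} {x y s : V} (hN : IsTTSP N x y) (hE : E ⊆ N) (hC : C ⊆ N)
    (hs : ∃ e ∈ N, s ∈ e) (hsx : s ≠ x) (hsy : s ≠ y) (μ : ℕ) : 0 ≤ lev2C E C x y s starXTab μ :=
  lev2C_nonneg_of_mval2C (fun _ hw => famT12C_nonneg hN hE hC hs hsx hsy hw 1) μ

/-- **`STAR(y; x, s) ≥ 0` levelwise on every minor.** [cite: AyyerLinussonRavichandran2025, §7 (p. 22)] -/
theorem starYC_level_nonneg {N E C : Finset (Sym2 V)} {x y s : V} (hN : IsTTSP N x y) (hE : E ⊆ N) (hC : C ⊆ N)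
    (hs : ∃ e ∈ N, s ∈ e) (hsx : s ≠ x) (hsy : s ≠ y) (μ : ℕ) : 0 ≤ lev2C E C x y s (mirror2 starXTab) μ :=
  lev2C_nonneg_of_mval2C (fun _ hw => famT12C_nonneg hN hE hC hs hsx hsy hw 2) μ

/-- **`STAR(s; x, y) ≥ 0` levelwise on every minor.** [cite: AyyerLinussonRavichandran2025, §7 (p. 22)] -/
theorem starSC_level_nonneg {N E C : Finset (Sym2 V)} {x y s : V} (hN : IsTTSP N x y) (hE : E ⊆ N) (hC : C ⊆ N)
    (hs : ∃ e ∈ N, s ∈ e) (hsx : s ≠ x) (hsy : s ≠ y) (μ : ℕ) : 0 ≤ lev2C E C x y s starSTab μ :=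
  lev2C_nonneg_of_mval2C (fun _ hw => famT12C_nonneg hN hE hC hs hsx hsy hw 3) μ

end MinorInduction

end FK

end Summit.CriticalPhenomena.PercolationContinuityZ3.Theorems
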